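import Summits.AtomisticToContinuum.Crystallization.Theorems.PalmUnimodularRigidityLayeredLawsSelectHcpCertificateDefs

/-!
# Route `PalmUnimodularRigidity`, crux `LayeredLawsSelectHcp` (stmt-AtomisticToContinuum-9226):
# certificate vocabulary, part B — near-admissible corrector data and local charts on the near ball

Addendum to `…CertificateDefs.lean` (lead c2, cycle 3).  The zero-mean theorem for directed orbit-sum correctors is proved by rewriting
the chart sum at the root as a sum over charts ROOTED AT THE RECEIVING ATOM that reads only labels of the NEAR BALL
`B₂ = {0} ∪ nearLabels` (graph ball of radius 2 = metric ball of radius 2 of the ideal hcp), and then as an iterated Campbell integral;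
this needs the corrector datum to read only near labels and to shift by a near label (`CorrDatum.NearAdmissible`, which implies
`CorrDatum.Admissible`), and the notion of a LOCAL CHART on the near ball (`IsLocalChart S z`: root at `0`, values in `S`, injective on
`B₂`, ideal unit struts ↔ bonds on `B₂ × B₂`), which for rooted hcp-charted tube configurations are exactly the restrictions of the twelve
rooted charts (registered sub-goal `tube_localChart_iff`).  Definitions with parameters only; `[folklore]`; the anchor
`nearAdmissible_admissible` is a registered sub-goal. -/

noncomputable section

namespace Summit.AtomisticToContinuum.Crystallization.Theorems.PalmUnimodularRigidity.LayeredLawsSelectHcp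

open MeasureTheory Set
open Literature.MathematicalPhysics.StatisticalMechanics Literature.Geometry.DiscreteGeometry

/-- The near ball of labels: the root together with the 56 near labels (graph ball of radius 2 of the ideal hcp). [folklore] -/
def nearBall : Finset (ℤ × ℤ × ℤ) :=
  insert 0 nearLabels

/-- **Near-admissible corrector datum**: the shift is a near-ball label and the functional reads the labelled configuration only on the
near ball, through a measurable bounded function. [folklore] -/
def CorrDatum.NearAdmissible (d : CorrDatum) : Prop :=
  d.shift ∈ nearBall ∧
    ∃ (ψ : (↥nearBall → EuclideanSpace ℝ (Fin 3)) → ℝ) (C : ℝ),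
      Measurable ψ ∧ (∀ X, d.φ X = ψ (fun u => X u)) ∧ ∀ X, |d.φ X| ≤ C

/-- **Local chart on the near ball** of a point set `S`: root at the origin, near-ball values in `S`, injective on the near ball, and
ideal unit struts ↔ bonds of `S` on the near ball. [folklore] -/
def IsLocalChart (S : Set (EuclideanSpace ℝ (Fin 3))) (z : ℤ × ℤ × ℤ → EuclideanSpace ℝ (Fin 3)) : Prop :=
  z 0 = 0 ∧ (∀ u ∈ nearBall, z u ∈ S) ∧ Set.InjOn z ↑nearBall ∧
    ∀ u ∈ nearBall, ∀ w ∈ nearBall,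
      dist (hcpSite 1 (Real.sqrt (2 / 3)) u) (hcpSite 1 (Real.sqrt (2 / 3)) w) = 1 ↔
        (0 < dist (z u) (z w) ∧ dist (z u) (z w) ≤ 28 / 25)

/-- The root is a near-ball label. [folklore] -/
theorem zero_mem_nearBall : (0 : ℤ × ℤ × ℤ) ∈ nearBall :=
  Finset.mem_insert_self _ _

/-- Near labels are near-ball labels. [folklore] -/
theorem mem_nearBall_of_mem_nearLabels {u : ℤ × ℤ × ℤ} (hu : u ∈ nearLabels) : u ∈ nearBall :=
  Finset.mem_insert_of_mem hu

/-- Anchor (registered sub-goal `nearAdmissible_admissible`): a near-admissible datum is admissible. [folklore] -/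
theorem nearAdmissible_admissible : ∀ d : CorrDatum, d.NearAdmissible → d.Admissible := by
  rintro d ⟨-, ψ, C, hψ, hφ, hC⟩
  exact ⟨nearBall, ψ, C, hψ, hφ, hC⟩

end Summit.AtomisticToContinuum.Crystallization.Theorems.PalmUnimodularRigidity.LayeredLawsSelectHcp

end
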